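import Literature.FieldTheory.AlgClosed.AutomorphismExtension
import Mathlib.FieldTheory.AlgebraicClosure
import Mathlib.FieldTheory.Galois.Infinite
import Mathlib.RingTheory.AlgebraicIndependent.TranscendenceBasis
import HarnessLib

/-!
# The fixed field of `Aut(Ω/F)` is `F`, for ANY subfield `F` of an algebraically closed field `Ω` of characteristic `0`

Topic `FieldTheory/AlgClosed`; a proofs-only sequel (theorems only, no definitions, no named facts, no `sorry`) of
★ `AutomorphismExtension.lean` ∕ ★ `AutFixedSubfield.lean`, which prove the statement for COUNTABLE subfields of `ℂ`
(cardinality argument).  Here the countability and cardinality hypotheses are removed: for an algebraically closed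
field `Ω` of characteristic `0`, an arbitrary field `F` with `Algebra F Ω`, and `z ∈ Ω` outside the image of `F`, there
is an `F`-algebra automorphism of `Ω` moving `z` (`exists_algEquiv_apply_ne`); equivalently the fixed field of
`Aut(Ω/F)` is `F` (`mem_range_algebraMap_of_forall_algEquiv`); for `Ω = ℂ` and a `Subfield ℂ` these are
`Complex.exists_ringEquiv_fix_apply_ne'` ∕ `Complex.mem_subfield_of_forall_ringEquiv'` (ED. 2; the countable-`F` forms in
★ `AutFixedSubfield.lean` are used by ≥ 10 CM ∕ Motives files, which may now drop the hypothesis `#F ≤ ℵ₀`).  This is the form needed by «let `σ ∈ Aut(Kˢᵉᵖ/k)` fix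
`τ(E)` …» descent arguments over an arbitrary (possibly uncountable, possibly transcendental) base, e.g. the
field-of-definition statements of [Lan2013], Cor. 1.1.2.11–1.1.2.16 (★ carpet
`AlgebraicGeometry/ModuliOfAbelianVarieties/Lan2013/Sec112Sec113DeterminantsProjectiveModules.lean`), whose separable
closure `Kˢᵉᵖ ⊇ K ⊇ k` need not be algebraic over the field `τ(E)`.

PROOF (Lang, *Algebra*, Ch. VIII §1 with Ch. V §2, the classical argument, no cardinal arithmetic):
* `exists_algEquiv_apply_eq_add_one_of_transcendental` — `z` transcendental over `F`: put `z` into a transcendence basis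
  `t` of `Ω/F` (Mathlib `exists_isTranscendenceBasis_superset`), let `θ` be the `F`-automorphism `X_z ↦ X_z + 1` of
  `F[t] ≅ F[X_i : i ∈ t]`, and extend `θ` to `Ω`, an algebraic closure of `F[t]`
  (`IsAlgClosed.isAlgClosure_of_transcendence_basis`, `IsAlgClosure.equivOfEquiv`): `σ z = z + 1`; any characteristic.
* `exists_algEquiv_apply_ne_of_isAlgebraic` — `z` algebraic over `F`, `z ∉ F`, characteristic `0`: the algebraic closure
  `F₁` of `F` in `Ω` is Galois over `F`, so some `σ₁ ∈ Gal(F₁/F)` moves `z` (Mathlib `InfiniteGalois.fixedField_bot`);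
  `σ₁` extends across a transcendence basis `s` of `Ω/F₁` to `F₁[s]` (acting on coefficients) and then to `Ω`.
Mathlib (this pin) has the fixed-field theorem only for (infinite) Galois, i.e. algebraic, extensions; searched
`lean search 'fixedField|equivOfTranscendenceBasis|≃ₐ\[.*\] Ω'` and the tree (`AutFixedSubfield`: countable `F ⊆ ℂ` only).

## References

* S. Lang, *Algebra*, rev. 3rd ed., GTM 211, Springer 2002, Ch. V §2 (extension of embeddings), Ch. VIII §1
  (transcendence bases; automorphisms of algebraically closed fields). [Lang2002]
* J. S. Milne, *Fields and Galois Theory* (v5.10, 2022), Ch. 9, «Transcendental extensions», Thm. 9.29 and the remarks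
  following it (automorphism group of an algebraically closed field).
-/

noncomputable section

open Polynomial

namespace Literature.FieldTheory.AlgClosed

universe u

variable {Ω : Type u} [Field Ω] {F : Type u} [Field F] [Algebra F Ω]

/-- **Transcendental elements are moved by `Aut(Ω/F)`.**  If `Ω` is algebraically closed and `z ∈ Ω` is transcendental over
`F`, there is an `F`-algebra automorphism `σ` of `Ω` with `σ z = z + 1 ≠ z`: put `z` in a transcendence basis `t` of `Ω/F`,
let `θ` be the `F`-automorphism `X_z ↦ X_z + 1` of `F[t] ≅ F[X_i : i ∈ t]`, and extend `θ` to the algebraic closure `Ω` of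
`F[t]` (Mathlib `IsAlgClosure.equivOfEquiv`). [cite: Lang2002, Ch. VIII §1 (with Ch. V §2, Thm. 2.8)] -/
theorem exists_algEquiv_apply_eq_add_one_of_transcendental [IsAlgClosed Ω] {z : Ω} (hz : Transcendental F z) :
    ∃ σ : Ω ≃ₐ[F] Ω, σ z = z + 1 := by
  classical
  -- a transcendence basis through `z`
  have hind : AlgebraicIndepOn F id ({z} : Set Ω) :=
    (algebraicIndependent_singleton_iff (⟨z, rfl⟩ : ({z} : Set Ω))).mpr hz
  obtain ⟨t, hzt, ht⟩ := exists_isTranscendenceBasis_superset hind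
  have hzt' : z ∈ t := hzt rfl
  let iz : t := ⟨z, hzt'⟩
  -- the shift automorphism `X_{iz} ↦ X_{iz} + 1` of `F[X_i : i ∈ t]`
  let g : t → MvPolynomial t F := fun i => if i = iz then MvPolynomial.X i + 1 else MvPolynomial.X i
  let g' : t → MvPolynomial t F := fun i => if i = iz then MvPolynomial.X i - 1 else MvPolynomial.X i
  have hgg' : (MvPolynomial.aeval g').comp (MvPolynomial.aeval g) = AlgHom.id F _ := by
    apply MvPolynomial.algHom_ext
    intro i
    rw [AlgHom.comp_apply, MvPolynomial.aeval_X, AlgHom.id_apply]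
    by_cases hi : i = iz
    · simp only [g, g', if_pos hi, map_add, map_one, MvPolynomial.aeval_X, sub_add_cancel]
    · simp only [g, g', if_neg hi, MvPolynomial.aeval_X]
  have hg'g : (MvPolynomial.aeval g).comp (MvPolynomial.aeval g') = AlgHom.id F _ := by
    apply MvPolynomial.algHom_ext
    intro i
    rw [AlgHom.comp_apply, MvPolynomial.aeval_X, AlgHom.id_apply]
    by_cases hi : i = iz
    · simp only [g, g', if_pos hi, map_sub, map_one, MvPolynomial.aeval_X, add_sub_cancel_right]
    · simp only [g, g', if_neg hi, MvPolynomial.aeval_X]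
  let θ : MvPolynomial t F ≃ₐ[F] MvPolynomial t F := AlgEquiv.ofAlgHom _ _ hg'g hgg'
  have hθ : ∀ p, θ p = MvPolynomial.aeval g p := fun p => rfl
  -- transport to `A = F[t] ⊆ Ω` and extend to `Ω`
  letI := IsAlgClosed.isAlgClosure_of_transcendence_basis _ ht
  set A := Algebra.adjoin F (Set.range ((↑) : t → Ω)) with hA
  let e' : A ≃+* A := (ht.1.aevalEquiv.symm.trans (θ.trans ht.1.aevalEquiv)).toRingEquiv
  have he'F : ∀ f : F, e' (algebraMap F A f) = algebraMap F A f := fun f =>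
    (ht.1.aevalEquiv.symm.trans (θ.trans ht.1.aevalEquiv)).commutes f
  have hzA : algebraMap A Ω (ht.1.aevalEquiv (MvPolynomial.X iz)) = z := by
    rw [AlgebraicIndependent.algebraMap_aevalEquiv, MvPolynomial.aeval_X]
  have he'z : e' (ht.1.aevalEquiv (MvPolynomial.X iz)) = ht.1.aevalEquiv (MvPolynomial.X iz + 1) := by
    change ht.1.aevalEquiv (θ (ht.1.aevalEquiv.symm (ht.1.aevalEquiv (MvPolynomial.X iz)))) = _
    rw [AlgEquiv.symm_apply_apply, hθ, MvPolynomial.aeval_X]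
    simp only [g, if_pos rfl]
  let σ₀ : Ω ≃+* Ω := IsAlgClosure.equivOfEquiv Ω Ω e'
  have hσ₀F : ∀ f : F, σ₀ (algebraMap F Ω f) = algebraMap F Ω f := by
    intro f
    rw [IsScalarTower.algebraMap_apply F A Ω, IsAlgClosure.equivOfEquiv_algebraMap, he'F]
  refine ⟨AlgEquiv.ofRingEquiv (f := σ₀) hσ₀F, ?_⟩
  change σ₀ z = z + 1
  conv_lhs => rw [← hzA]
  rw [IsAlgClosure.equivOfEquiv_algebraMap, he'z, AlgebraicIndependent.algebraMap_aevalEquiv, map_add,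
    MvPolynomial.aeval_X, map_one]

/-- **Algebraic non-rational elements are moved by `Aut(Ω/F)` (characteristic `0`).**  If `Ω` is algebraically closed of
characteristic `0` and `z ∈ Ω` is algebraic over `F` but not in `F`, there is an `F`-algebra automorphism of `Ω` moving
`z`: the algebraic closure `F₁` of `F` in `Ω` is Galois over `F` (characteristic `0`), so some `σ₁ ∈ Gal(F₁/F)` moves `z`
(Mathlib `InfiniteGalois.fixedField_bot`); extend `σ₁` across a transcendence basis of `Ω/F₁` and then to the algebraic
closure `Ω` (`IsAlgClosure.equivOfEquiv`). [cite: Lang2002, Ch. V §2 Thm. 2.8 with Ch. VIII §1] -/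
theorem exists_algEquiv_apply_ne_of_isAlgebraic [IsAlgClosed Ω] [CharZero Ω] {z : Ω} (hz : IsAlgebraic F z)
    (hzF : z ∉ Set.range (algebraMap F Ω)) : ∃ σ : Ω ≃ₐ[F] Ω, σ z ≠ z := by
  classical
  haveI : CharZero F := (algebraMap F Ω).charZero
  let F₁ : IntermediateField F Ω := algebraicClosure F Ω
  have hz₁ : z ∈ F₁ := (mem_algebraicClosure_iff).mpr hz
  let z₁ : F₁ := ⟨z, hz₁⟩
  -- some `σ₁ ∈ Gal(F₁/F)` moves `z`
  have hσ₁ : ∃ σ₁ : F₁ ≃ₐ[F] F₁, σ₁ z₁ ≠ z₁ := by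
    by_contra h
    have h' : ∀ σ₁ : F₁ ≃ₐ[F] F₁, σ₁ z₁ = z₁ := fun σ₁ => not_not.mp (not_exists.mp h σ₁)
    have hmem : z₁ ∈ IntermediateField.fixedField (⊤ : Subgroup (F₁ ≃ₐ[F] F₁)) := fun σ => h' σ
    rw [InfiniteGalois.fixedField_bot, IntermediateField.mem_bot] at hmem
    obtain ⟨f, hf⟩ := hmem
    exact hzF ⟨f, by rw [IsScalarTower.algebraMap_apply F F₁ Ω, hf]; rfl⟩
  obtain ⟨σ₁, hσ₁⟩ := hσ₁
  -- extend `σ₁` across a transcendence basis of `Ω / F₁`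
  obtain ⟨s, hs⟩ := exists_isTranscendenceBasis F₁ Ω
  letI := IsAlgClosed.isAlgClosure_of_transcendence_basis _ hs
  set A := Algebra.adjoin F₁ (Set.range ((↑) : s → Ω)) with hA
  let em : MvPolynomial s F₁ ≃+* MvPolynomial s F₁ := MvPolynomial.mapEquiv s σ₁.toRingEquiv
  let e' : A ≃+* A := (hs.1.aevalEquiv.symm.toRingEquiv.trans em).trans hs.1.aevalEquiv.toRingEquiv
  have he' : ∀ y : F₁, e' (algebraMap F₁ A y) = algebraMap F₁ A (σ₁ y) := by
    intro y
    have h1 : hs.1.aevalEquiv.symm (algebraMap F₁ A y) = MvPolynomial.C y := by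
      rw [AlgEquiv.symm_apply_eq, ← MvPolynomial.algebraMap_eq, AlgEquiv.commutes]
    have h2 : em (MvPolynomial.C y) = MvPolynomial.C (σ₁ y) := by
      change MvPolynomial.mapEquiv s σ₁.toRingEquiv (MvPolynomial.C y) = _
      rw [MvPolynomial.mapEquiv_apply, MvPolynomial.map_C]
      rfl
    change hs.1.aevalEquiv (em (hs.1.aevalEquiv.symm _)) = _
    rw [h1, h2, ← MvPolynomial.algebraMap_eq, AlgEquiv.commutes]
  let σ₀ : Ω ≃+* Ω := IsAlgClosure.equivOfEquiv Ω Ω e'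
  have hσ₀ : ∀ y : F₁, σ₀ (algebraMap F₁ Ω y) = algebraMap F₁ Ω (σ₁ y) := by
    intro y
    rw [IsScalarTower.algebraMap_apply F₁ A Ω, IsAlgClosure.equivOfEquiv_algebraMap, he',
      ← IsScalarTower.algebraMap_apply]
  have hσ₀F : ∀ f : F, σ₀ (algebraMap F Ω f) = algebraMap F Ω f := by
    intro f
    rw [IsScalarTower.algebraMap_apply F F₁ Ω, hσ₀, AlgEquiv.commutes]
  refine ⟨AlgEquiv.ofRingEquiv (f := σ₀) hσ₀F, ?_⟩
  change σ₀ z ≠ z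
  have hz' : z = algebraMap F₁ Ω z₁ := rfl
  rw [hz', hσ₀]
  exact fun h => hσ₁ ((algebraMap F₁ Ω).injective h)

/-- **The fixed field of `Aut(Ω/F)` is `F`.**  For an algebraically closed field `Ω` of characteristic `0` and any subfield
`F` (an `F`-algebra structure on `Ω`), every `z ∈ Ω ∖ F` is moved by some `F`-automorphism of `Ω`; no countability or
cardinality hypothesis (compare ★ `Complex.exists_ringEquiv_fix_apply_ne`, countable `F ⊆ ℂ`).
[cite: Lang2002, Ch. VIII §1 with Ch. V §2 Thm. 2.8] -/
theorem exists_algEquiv_apply_ne [IsAlgClosed Ω] [CharZero Ω] {z : Ω} (hzF : z ∉ Set.range (algebraMap F Ω)) :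
    ∃ σ : Ω ≃ₐ[F] Ω, σ z ≠ z := by
  by_cases hz : IsAlgebraic F z
  · exact exists_algEquiv_apply_ne_of_isAlgebraic hz hzF
  · obtain ⟨σ, hσ⟩ := exists_algEquiv_apply_eq_add_one_of_transcendental (Ω := Ω) hz
    exact ⟨σ, by rw [hσ]; exact fun h => one_ne_zero ((add_eq_left).mp h)⟩

/-- Contrapositive form: an element of `Ω` fixed by every `F`-automorphism of the algebraically closed characteristic-`0`
field `Ω` lies in `F`. [cite: Lang2002, Ch. VIII §1 with Ch. V §2 Thm. 2.8] -/
theorem mem_range_algebraMap_of_forall_algEquiv [IsAlgClosed Ω] [CharZero Ω] {z : Ω}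
    (h : ∀ σ : Ω ≃ₐ[F] Ω, σ z = z) : z ∈ Set.range (algebraMap F Ω) := by
  by_contra hz
  obtain ⟨σ, hσ⟩ := exists_algEquiv_apply_ne hz
  exact hσ (h σ)

/-! ### The case `Ω = ℂ`: countability-free forms of ★ `AutFixedSubfield.lean` -/

/-- **Every `z ∉ F` is moved by some automorphism of `ℂ` fixing the subfield `F ⊆ ℂ` pointwise** — for an ARBITRARY subfield
`F` (countability-free form of ★ `Complex.exists_ringEquiv_fix_apply_ne`, which assumes `#F ≤ ℵ₀`).
[cite: Lang2002, Ch. VIII §1 with Ch. V §2 Thm. 2.8] -/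
theorem Complex.exists_ringEquiv_fix_apply_ne' (F : Subfield ℂ) {z : ℂ} (hz : z ∉ F) :
    ∃ σ : ℂ ≃+* ℂ, (∀ x ∈ F, σ x = x) ∧ σ z ≠ z := by
  have hz' : z ∉ Set.range (algebraMap F ℂ) := by
    rintro ⟨y, rfl⟩
    exact hz y.2
  obtain ⟨σ, hσ⟩ := exists_algEquiv_apply_ne (Ω := ℂ) (F := F) hz'
  exact ⟨σ.toRingEquiv, fun x hx => σ.commutes ⟨x, hx⟩, hσ⟩

/-- **The fixed field of `Aut(ℂ/F)` is `F`, for every subfield `F ⊆ ℂ`** (countability-free form of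
★ `Complex.mem_subfield_of_forall_ringEquiv`). [cite: Lang2002, Ch. VIII §1 with Ch. V §2 Thm. 2.8] -/
theorem Complex.mem_subfield_of_forall_ringEquiv' (F : Subfield ℂ) {z : ℂ}
    (h : ∀ σ : ℂ ≃+* ℂ, (∀ x ∈ F, σ x = x) → σ z = z) : z ∈ F := by
  by_contra hz
  obtain ⟨σ, hfix, hne⟩ := Complex.exists_ringEquiv_fix_apply_ne' F hz
  exact hne (h σ hfix)

end Literature.FieldTheory.AlgClosed
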